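import Literature.NumberTheory.EllipticCurves.IwasawaEisensteinTwistedRep
import Literature.NumberTheory.EllipticCurves.ZpExtensionGaloisTwist
import HarnessLib

/-!
# The Eisenstein twisting character `χ_κ : Γ_K →* A_{m,k}`, `σ ↦ (1+T)^{κ(σ) mod p^J}`, and the dictionary
# `eisensteinTwist σ x = χ_κ σ • (1 ⊗ ρ σ) x` with the cocycle files' `TwistedBy` action

Topic `NumberTheory/EllipticCurves` (sequel to `ZpExtensionScalarTwist` (D1's `eisensteinTwist`), `ZpExtensionGaloisTwist`
(`twistExponent` API) and `IwasawaEisensteinTwistedRep`; cell `pub/bsd-print-x9`, blueprint HOME/p2/S1-DISCRETE-CONTROL §1,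
the dictionary between the `galoisCohomology ((κ.unitTwist (-1)).eisensteinTwist ρ hm k)` currency of the compact side and the
`TwistedBy χ M` currency of the discrete-side cocycle files).  One definition with body (`eisensteinTwistChar`, a monoid
homomorphism) and theorems; no named fact, no instance, no `sorry`.

* `ZpExtension.eisensteinTwistChar κ hm k : Γ_K →* A_{m,k}`, `σ ↦ onePlusT ^ twistExponent κ J σ`, `J = eisensteinLevel hm k`
  (multiplicative because `(1+T)^{p^J} = 1`); `= 1` on `ker κ` and on the open layer subgroup `κ⁻¹(p^J ℤ_p)`;
* **`eisensteinTwistChar_unitTwist_neg_one_mul_onePlusT`**: for a topological generator `γ` of `κ`, the INVERSE twist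
  `κ⁻ = κ.unitTwist (-1)` satisfies `χ_{κ⁻}(γ) · (1+T) = 1` — the hypothesis `hχγ` of the cocycle/descent files;
* **`eisensteinTwist_apply_eq_smul_mapEnd`**: `κ.eisensteinTwist ρ hm k σ x = χ_κ σ • CoeffExtension.mapEnd (ρ σ) x` — the
  action of D1's twisted module IS the `TwistedBy` action `χ σ • (1 ⊗ σ)` once `ρ σ` is the given action on `M`
  (`eisensteinTwist_apply_eq_twistedBy_smul` for a `DistribMulAction` agreeing with `ρ`).

References: [Howard2004HeegnerKolyvagin] §2.2 (`T_𝔮 = T ⊗ S_𝔮`, `γ ↦ γ`), proof of Thm. 2.2.10; [Washington1997] §13.1–§13.2;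
[GreenbergLNM1716] §4 p. 107.  BSD is not proved by any of this.
-/

noncomputable section

open Literature.NumberTheory.EllipticCurves Literature.NumberTheory.GaloisRepresentations Field

universe u

namespace Literature.NumberTheory.EllipticCurves

namespace ZpExtension

variable {K : Type u} [Field K] {p : ℕ} [hp : Fact p.Prime] (κ : ZpExtension K p) {m : ℕ} (hm : 1 ≤ m) (k : ℕ)

/-- `(1+T)^n` only depends on `n mod p^J`, `J = eisensteinLevel`. [cite: Washington1997, §13.2] -/
theorem onePlusT_pow_mod_eisensteinLevel (n : ℕ) :
    IwasawaAlgebra.EisensteinCoeff.onePlusT p m k ^ (n % p ^ eisensteinLevel (p := p) hm k) =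
      IwasawaAlgebra.EisensteinCoeff.onePlusT p m k ^ n := by
  conv_rhs => rw [← Nat.mod_add_div n (p ^ eisensteinLevel (p := p) hm k), pow_add, pow_mul,
    onePlusT_pow_prime_pow_eisensteinLevel (p := p) hm k, one_pow, mul_one]

/-- **The Eisenstein twisting character `χ_κ : Γ_K →* A_{m,k}`, `σ ↦ (1+T)^{κ(σ) mod p^J}`** — the values of Howard's
`Γ_K ↠ Gal(K_∞/K) → Λˣ → A_{m,k}ˣ`, `γ ↦ 1 + T`, as a monoid homomorphism into `A_{m,k}`.
[cite: Howard2004HeegnerKolyvagin, §2.2 (Γ_K acts on Λ through γ ↦ γ = 1 + T)] [cite: Washington1997, §13.2] -/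
def eisensteinTwistChar : absoluteGaloisGroup K →* IwasawaAlgebra.EisensteinCoeff p m k where
  toFun σ := IwasawaAlgebra.EisensteinCoeff.onePlusT p m k ^ κ.twistExponent (eisensteinLevel (p := p) hm k) σ
  map_one' := by rw [twistExponent_one, pow_zero]
  map_mul' σ τ := by rw [twistExponent_mul, onePlusT_pow_mod_eisensteinLevel, pow_add]

/-- Unfolding `eisensteinTwistChar`. [cite: Howard2004HeegnerKolyvagin, §2.2] -/
theorem eisensteinTwistChar_apply (σ : absoluteGaloisGroup K) :
    κ.eisensteinTwistChar hm k σ =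
      IwasawaAlgebra.EisensteinCoeff.onePlusT p m k ^ κ.twistExponent (eisensteinLevel (p := p) hm k) σ := rfl

/-- `χ_κ = 1` on `Gal(K̄/K_∞) = ker κ`. [cite: Washington1997, §13.2] -/
theorem eisensteinTwistChar_eq_one_of_mem_kerSubgroup {σ : absoluteGaloisGroup K} (hσ : σ ∈ κ.kerSubgroup) :
    κ.eisensteinTwistChar hm k σ = 1 := by
  rw [eisensteinTwistChar_apply, κ.twistExponent_eq_zero_of_mem_kerSubgroup hσ, pow_zero]

/-- `χ_κ = 1` on the OPEN subgroup `κ⁻¹(p^J ℤ_p)` (`J = eisensteinLevel`; `isOpen_layerSubgroup`) — `χ_κ` is locally constant.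
[cite: Washington1997, §13.1–§13.2] -/
theorem eisensteinTwistChar_eq_one_of_mem_layerSubgroup {σ : absoluteGaloisGroup K}
    (hσ : σ ∈ κ.layerSubgroup (eisensteinLevel (p := p) hm k)) : κ.eisensteinTwistChar hm k σ = 1 := by
  rw [eisensteinTwistChar_apply, κ.twistExponent_eq_zero_of_mem_layerSubgroup hσ, pow_zero]

/-- **The inverse twist at a topological generator: `χ_{κ⁻}(γ) · (1+T) = 1`**, `κ⁻ = κ.unitTwist (-1)`, `κ γ = 1`
(the hypothesis `hχγ` of the twisted-cocycle / descent files; the sign of D1's `St`, x10b-p1 LEAD 17:27:04Z).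
[cite: Howard2004HeegnerKolyvagin, §2.2 and proof of Thm. 2.2.10] [cite: Washington1997, §13.2] -/
theorem eisensteinTwistChar_unitTwist_neg_one_mul_onePlusT {γ : absoluteGaloisGroup K} (hγ : κ.IsTopGenerator γ) :
    (κ.unitTwist (-1)).eisensteinTwistChar hm k γ * IwasawaAlgebra.EisensteinCoeff.onePlusT p m k = 1 := by
  rw [eisensteinTwistChar_apply, ← pow_succ]
  set J := eisensteinLevel (p := p) hm k with hJ
  have hval : (κ.unitTwist (-1)).twistExponent J γ = (-1 : ZMod (p ^ J)).val := by
    rw [twistExponent, unitTwist_apply, toAdd_ofAdd, show κ γ = Multiplicative.ofAdd 1 from hγ, toAdd_ofAdd, mul_one,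
      Units.val_neg, Units.val_one, map_neg, map_one]
  rw [hval]
  rcases Nat.eq_zero_or_pos J with hJ0 | hJpos
  · -- `J = 0`: `(1+T)^{p^0} = 1`, i.e. `1 + T = 1`
    have h1 : IwasawaAlgebra.EisensteinCoeff.onePlusT p m k = 1 := by
      have := onePlusT_pow_prime_pow_eisensteinLevel (p := p) hm k
      rwa [← hJ, hJ0, pow_zero, pow_one] at this
    rw [h1, one_pow]
  · haveI : Fact (1 < p ^ J) := ⟨Nat.one_lt_pow hJpos.ne' hp.out.one_lt⟩
    rw [ZMod.val_neg_of_ne_zero, ZMod.val_one, Nat.sub_add_cancel (Nat.one_lt_pow hJpos.ne' hp.out.one_lt).le]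
    exact onePlusT_pow_prime_pow_eisensteinLevel (p := p) hm k

variable {M : Type u} [AddCommGroup M] [TopologicalSpace M] [DiscreteTopology M]

/-- **Dictionary**: D1's twisted action is `χ_κ σ • (1 ⊗ ρ σ)` on `A_{m,k} ⊗ M` —
`κ.eisensteinTwist ρ hm k σ x = χ_κ σ • CoeffExtension.mapEnd (ρ σ) x`.
[cite: Howard2004HeegnerKolyvagin, §2.2 (the diagonal action on T ⊗ S_𝔮)] [cite: GreenbergLNM1716, §4 p. 107] -/
theorem eisensteinTwist_apply_eq_smul_mapEnd (ρ : DiscreteGaloisModule K M) (σ : absoluteGaloisGroup K)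
    (x : IwasawaAlgebra.EisensteinCoeff.Twisted p m k M) :
    κ.eisensteinTwist ρ hm k σ x =
      κ.eisensteinTwistChar hm k σ • CoeffExtension.mapEnd ((ρ σ).toAddMonoidHom : AddMonoid.End M) x := by
  rw [eisensteinTwist_apply_apply, eisensteinTwistChar_apply]
  congr 1

/-- **Dictionary with the `TwistedBy` action**: if the `Γ_K`-action on `M` is that of `ρ` (`ρ σ a = σ • a`), then
`κ.eisensteinTwist ρ hm k σ x = ofTwisted⁻¹ (σ • ofTwisted x)` in `TwistedBy (eisensteinTwistChar κ hm k) M` — the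
1-cocycles of D1's `eisensteinTwist` are exactly the twisted crossed homomorphisms of the cocycle files.
[cite: Howard2004HeegnerKolyvagin, §2.2] [cite: GreenbergLNM1716, §4 p. 107] -/
theorem eisensteinTwist_apply_eq_twistedBy_smul [DistribMulAction (absoluteGaloisGroup K) M]
    (ρ : DiscreteGaloisModule K M) (hρ : ∀ (σ : absoluteGaloisGroup K) (a : M), ρ σ a = σ • a)
    (σ : absoluteGaloisGroup K) (x : IwasawaAlgebra.EisensteinCoeff.Twisted p m k M) :
    κ.eisensteinTwist ρ hm k σ x =
      (IwasawaAlgebra.EisensteinCoeff.TwistedBy.ofTwisted (κ.eisensteinTwistChar hm k) M).symm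
        (σ • IwasawaAlgebra.EisensteinCoeff.TwistedBy.ofTwisted (κ.eisensteinTwistChar hm k) M x) := by
  rw [IwasawaAlgebra.EisensteinCoeff.TwistedBy.ofTwisted_symm_smul, AddEquiv.symm_apply_apply,
    eisensteinTwist_apply_eq_smul_mapEnd]
  refine congrArg (κ.eisensteinTwistChar hm k σ • ·) ?_
  induction x using IwasawaAlgebra.EisensteinCoeff.Twisted.induction_on with
  | zero => rw [map_zero, map_zero]
  | tmul c a => rw [CoeffExtension.mapEnd_tmul, CoeffExtension.mapEnd_tmul]; exact congrArg _ (hρ σ a)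
  | add x y hx hy => rw [map_add, map_add, hx, hy]

end ZpExtension

end Literature.NumberTheory.EllipticCurves
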